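import Mathlib
import Summits.QuantumAdvantage.QuantumAdvantage.Theses.SpinorFlattening
import Literature.Computability.QuantumComplexity.GaussianRank

/-!
# Sketch — crux-ideate stmt-QuantumAdvantage-1248 (GaussRankTwoCopies), gen 2 · round 1 · ideator 1

Idea card `annihilator-peeling-spin14` ("Sylvester peeling"): an annihilator `b ∈ L₃` of the third
term maps a putative 3-term Gaussian decomposition of `M⊗M` to a 2-term decomposition of the ODD
vector `c(b)(M⊗M)` (Clifford multiplication by an isotropic vector sends pure spinors to pure
spinors or to zero), and 2-term decompositions ARE excluded by the quadratic Clifford flattening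
(`2 · 29 = 58 < 59 ≤ rank`).  The admissible `b` (isotropic, nonzero on both 4-qubit blocks) form
TEN orbits under the explicit group `SL(4)_A × SL(4)_B × ℂˣ` of number-preserving special
Bogoliubov maps `1 + t a_i† a_j` (which fix `M⊗M` exactly), and on all ten representatives the
rank is `68` or `78 ≥ 59` (exact mod-p computation, compute/peel2.py, two primes).

Statements only (crux-ideate stage); every constant is a tree declaration
(`Literature.Computability.QuantumComplexity.majorana / IsGaussian / magicMPow`,
`Literature.Computability.Cryptography.QReg`).
-/

noncomputable section

set_option linter.dupNamespace false

namespace Summit.QuantumAdvantage.QuantumAdvantage.Cruxes.GaussRankTwoCopies.Peeling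

open Literature.Computability.Cryptography Literature.Computability.QuantumComplexity Matrix
open Summit.QuantumAdvantage.QuantumAdvantage.Theses.SpinorFlattening (GaussRankTwoCopies)

/-- Index set of the 16 Jordan–Wigner Majoranas on `2 * 4` wires: `(j, b) ↦ c_{j,X}` / `c_{j,Y}`. -/
abbrev MajIdx := Fin (2 * 4) × Bool

/-- Clifford multiplication by a vector `b ∈ V = ℂ¹⁶`: `c(b) = Σ_p b_p c_p`. -/
def cliff (b : MajIdx → ℂ) : Matrix (QReg (2 * 4)) (QReg (2 * 4)) ℂ :=
  ∑ p : MajIdx, b p • majorana (2 * 4) p.1 p.2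

/-- The invariant bilinear form on `V`: `c(b) c(b') + c(b') c(b) = 2 β(b, b') · 1`. -/
def betaV (b b' : MajIdx → ℂ) : ℂ := ∑ p : MajIdx, b p * b' p

/-- The quadratic Clifford span ("tangent-cone data") of a vector `w`:
`ℂ w + span {c_p c_q w}` — the image of the `K = 2` Clifford flattening, `w` included
(`c_p c_p = 1`). For a pure spinor its dimension is `29 = D₂(8)`; for `M⊗M` it is `79`. -/
def quadSpan (w : QReg (2 * 4) → ℂ) : Submodule ℂ (QReg (2 * 4) → ℂ) :=
  Submodule.span ℂ ({w} ∪ Set.range (fun pq : MajIdx × MajIdx =>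
    (majorana (2 * 4) pq.1.1 pq.1.2 * majorana (2 * 4) pq.2.1 pq.2.2) *ᵥ w))

/-- ADMISSIBLE peeling vectors: isotropic, and nonzero on BOTH blocks (wires `0–3` and `4–7`).
(An annihilator supported on one block only peels `M⊗M` to `(pure) ⊗ M`, of rank `2`: useless.) -/
def Admissible (b : MajIdx → ℂ) : Prop :=
  betaV b b = 0 ∧ (∃ p : MajIdx, p.1.val < 4 ∧ b p ≠ 0) ∧ (∃ p : MajIdx, 4 ≤ p.1.val ∧ b p ≠ 0)

/-- **(P1) PEELING LEMMA — the lever's first checkable statement.** Clifford multiplication by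
an ISOTROPIC vector maps a Gaussian state to `0` (iff `b` lies in its annihilator Lagrangian `L`)
or to a Gaussian state (annihilators `ℂ b ⊕ (L ∩ b^⊥)`, dimension `1 + 7 = 8`). Chevalley 1954
III.1; in the tree's vocabulary it generalises `IsGaussian.majorana_mulVec`. -/
def PeelGaussian : Prop :=
  ∀ (b : MajIdx → ℂ) (g : QReg (2 * 4) → ℂ), betaV b b = 0 → IsGaussian g →
    cliff b *ᵥ g = 0 ∨ IsGaussian (cliff b *ᵥ g)

/-- **(P2)** every Gaussian state has an ADMISSIBLE annihilator: its annihilator space `L` is an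
8-dimensional isotropic subspace of `V = V_A ⊕ V_B`, and isotropic subspaces of the non-degenerate
8-dimensional blocks have dimension `≤ 4`, so `L ⊄ V_A ∪ V_B`. -/
def AdmissibleAnnihilator : Prop :=
  ∀ g : QReg (2 * 4) → ℂ, IsGaussian g → ∃ b : MajIdx → ℂ, Admissible b ∧ cliff b *ᵥ g = 0

/-- **(P3)** rank-two tangent deficiency: the quadratic Clifford span of a combination of two
Gaussian states has dimension `≤ 2 · 29 = 58` (normal ordering: `quadSpan u ⊆ ℂu + Λ²L'·u`). -/
def RankTwoDeficiency : Prop :=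
  ∀ (a₁ a₂ : ℂ) (u₁ u₂ : QReg (2 * 4) → ℂ), IsGaussian u₁ → IsGaussian u₂ →
    Module.finrank ℂ (quadSpan (a₁ • u₁ + a₂ • u₂)) ≤ 58

/-- **(P4) THE TEN-ORBIT RANK CERTIFICATE (load-bearing computation).** For every admissible `b`,
the peeled vector `c(b)(M⊗M)` has quadratic Clifford span of dimension `≥ 59` (computed: `78` on
the non-null orbit, `68` on the nine null orbits; compute/peel2.py, exact mod `10⁹+9` and mod
`998244353`). Reduction to ten vectors: the transvections `1 + t a_i† a_j` (`i ≠ j` in one block)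
fix `M⊗M`, normalise `V`, preserve Gaussianity and `finrank ∘ quadSpan`, and act on
`b = (x_A, ξ_A; x_B, ξ_B) ∈ (ℂ⁴ ⊕ ℂ⁴*)²` by `SL(4) × SL(4)` (row reduction). -/
def PeeledRankBound : Prop :=
  ∀ b : MajIdx → ℂ, Admissible b → 59 ≤ Module.finrank ℂ (quadSpan (cliff b *ᵥ magicMPow 2))

/-- **(P0)** two terms never suffice: `dim quadSpan (M⊗M) = 79 ≥ 59` (the route's `K = 2`
flattening count `64 > 58`, here as one finite rank certificate). -/
def TwoTermsFree : Prop := 59 ≤ Module.finrank ℂ (quadSpan (magicMPow 2))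

/-- **Wiring claim** (ten lines of logic, no parity case split): given `M⊗M = Σ_{i<3} aᵢ gᵢ`,
take an admissible annihilator `b` of `g₂` (P2); `c(b)(M⊗M) = a₀ c(b)g₀ + a₁ c(b)g₁` is a
combination of two Gaussian-or-zero vectors (P1), so its quadratic span has dimension `≤ 58`
(P3) — contradicting (P4). (P0 is not even needed: a vanishing `c(b) gᵢ` is absorbed with
coefficient `0`.) -/
def WiringClaim : Prop :=
  PeelGaussian → AdmissibleAnnihilator → RankTwoDeficiency → PeeledRankBound → GaussRankTwoCopies

/-- The crux's inline `maj / IsGauss / Mpow` are definitionally the tree's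
`majorana / IsGaussian / magicMPow` (as in `Disproof.crux_iff`). -/
example : GaussRankTwoCopies ↔
    ∀ (a : Fin 3 → ℂ) (g : Fin 3 → QReg (2 * 4) → ℂ), (∀ i, IsGaussian (g i)) →
      magicMPow 2 ≠ ∑ i, a i • g i := Iff.rfl

/-- The wiring, PROVED (so a crux-plan skeleton `GaussRankTwoCopies_of` is immediate). -/
theorem wiringClaim_holds : WiringClaim := by
  intro hP1 hP2 hP3 hP4
  show ∀ (a : Fin 3 → ℂ) (g : Fin 3 → QReg (2 * 4) → ℂ), (∀ i, IsGaussian (g i)) →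
      magicMPow 2 ≠ ∑ i, a i • g i
  intro a g hg heq
  obtain ⟨b, hadm, hb⟩ := hP2 (g 2) (hg 2)
  -- peel: c(b) (M⊗M) = a 0 • c(b) g 0 + a 1 • c(b) g 1
  have hpeel : cliff b *ᵥ magicMPow 2 =
      a 0 • (cliff b *ᵥ g 0) + a 1 • (cliff b *ᵥ g 1) := by
    rw [heq, Fin.sum_univ_three, Matrix.mulVec_add, Matrix.mulVec_add, Matrix.mulVec_smul,
      Matrix.mulVec_smul, Matrix.mulVec_smul, hb, smul_zero, add_zero]
  -- each peeled term is zero or Gaussian; write both as (coefficient) • (Gaussian)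
  have hrepr : ∀ i : Fin 3, ∃ (c : ℂ) (u : QReg (2 * 4) → ℂ), IsGaussian u ∧
      a i • (cliff b *ᵥ g i) = c • u := by
    intro i
    rcases hP1 b (g i) hadm.1 (hg i) with h0 | hG
    · exact ⟨0, g i, hg i, by rw [h0, smul_zero, zero_smul]⟩
    · exact ⟨a i, cliff b *ᵥ g i, hG, rfl⟩
  obtain ⟨c₀, u₀, hu₀, e₀⟩ := hrepr 0
  obtain ⟨c₁, u₁, hu₁, e₁⟩ := hrepr 1
  have hle : Module.finrank ℂ (quadSpan (cliff b *ᵥ magicMPow 2)) ≤ 58 := by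
    rw [hpeel, e₀, e₁]
    exact hP3 c₀ c₁ u₀ u₁ hu₀ hu₁
  have hge := hP4 b hadm
  omega


/-! ### Quantitative peeling at `r = 2` (Transfer, by-product)

`‖c(b)‖_op = √2` for unit isotropic `b`, `‖c(b)(M⊗M)‖ = ‖b‖` (zero covariance of `M⊗M`), and
`|⟨u, c(b)(M⊗M)⟩|² = |⟨c(b̄)u, M⊗M⟩|² ≤ 2 · F_G(M⊗M) = 1/2` for unit Gaussian `u` (PeelGaussian applied to
`b̄`): peeling a 2-term combination by `b ∈ L₂` leaves ONE Gaussian term at distance² `≥ 1/2` from the unit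
vector `c(b)(M⊗M)`, whence `dist²(M⊗M, σ̂₂) ≥ 1/4` — thirty times the route's robust-flattening constant
`1/C(16,2) = 1/120` at `(t, K, r) = (2, 2, 2)`, half the conjectured `1/2` (Disproof §3). -/

/-- `F_G(M⊗M) ≤ 1/4` in coordinates (Dias–Koenig 2024, Thm 5.10: the Gaussian fidelity is multiplicative for
positive-parity 4-mode factors, `F_G(M) = 1/2`); consumed as a hypothesis. -/
def GaussFidelityQuarter : Prop :=
  ∀ u : QReg (2 * 4) → ℂ, IsGaussian u →
    4 * ‖∑ x, star (u x) * magicMPow 2 x‖ ^ 2 ≤ normSq u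

/-- `DistBound 2 (1/4)`: every 2-term Gaussian combination is at `normSq`-distance `≥ 1/4` from `M⊗M`. -/
def DistBoundTwoQuarter : Prop :=
  ∀ (a : Fin 2 → ℂ) (g : Fin 2 → QReg (2 * 4) → ℂ), (∀ i, IsGaussian (g i)) →
    (1 / 4 : ℝ) ≤ normSq (magicMPow 2 - ∑ i, a i • g i)

/-- The quantitative wiring at `r = 2` (paper proof in the card's Transfer field; operator-norm and
zero-covariance lemmas ride as supports). -/
def QuantPeelClaim : Prop := PeelGaussian → GaussFidelityQuarter → DistBoundTwoQuarter

end Summit.QuantumAdvantage.QuantumAdvantage.Cruxes.GaussRankTwoCopies.Peeling
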